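import Summits.ResolutionOfSingularities.ResolutionOfSingularities.Theses.HomologicalConductor
import Summits.ResolutionOfSingularities.ResolutionOfSingularities.Theorems.HomologicalConductorStrictDropTowerDimAntitone
import HarnessLib

/-!
# Crux `StrictDrop` (stmt-ResolutionOfSingularities-16485), line `birth` — the kernel SPLITS BY TERMINAL DIMENSION

Route `ResolutionOfSingularities/HomologicalConductor`, crux #4 `StrictDrop`, registered skeleton
`Cruxes/StrictDrop/Lines/birth.lean` (v4, sha16 `0bb865f43b01e4a8`), whose one open obligation is the kernel
`stub_dichotomy_dimGETwo` (drop or freeze from a stage `m` all of whose successors are singular of Krull dimension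
`≥ 2`; ≡ the crux, `HomologicalConductorStrictDropKernelIff`).  OURS (cell decomp-res, hand
leafhand-res-homologicalconduct-3); AI-written bookkeeping over the landed tower-dimension lemma
(`NoZeno.Birth.exists_ringKrullDim_tower_eventually_eq`, p798979), weaker than expert review; nothing here is a
statement of any manuscript under review.  SUPPORT-level; no stub, crux, route or summit statement is proved here.

* `dichotomy_dimGETwo_iff_forall_terminalDim` — **the kernel, verbatim, is EQUIVALENT to the conjunction over
  `e ≥ 2` of its TERMINAL-DIMENSION-`e` slices**: the same text with the extra hypothesis
  `∃ m₀ ≥ m, ∀ n ≥ m₀, dim T_n = e` inserted after the dimension hypothesis.  (⇐): the Krull dimension of the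
  stages is a non-increasing, hence eventually constant, natural number (`HomologicalConductorStrictDropTowerDimAntitone`);
  on a run of stages of dimension `≥ 2` its terminal value `e` is `≥ 2`.  (⇒): drop the hypothesis.
  The slice `e = 2` with `tr.deg_k K = 2` is settled by the kill test `SurfaceTermination`
  (`HomologicalConductorStrictDropOfSurfaceTermination`); `e = 2` at centres of positive residue transcendence
  degree and every `e ≥ 3` are what remains crux-sized — a reshape offered to the planner, not registered here.

References (mechanism only): H. Matsumura, *Commutative Ring Theory*, Thm. 15.5 [`Matsumura1987`].
-/

noncomputable section

-- single-problem summit: the doubled namespace component `ResolutionOfSingularities` is forced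
set_option linter.dupNamespace false

namespace Summit.ResolutionOfSingularities.ResolutionOfSingularities.Theorems.StrictDrop.Birth.TerminalDim

open Summit.ResolutionOfSingularities.ResolutionOfSingularities.Theorems.NoZeno.Birth
  (exists_ringKrullDim_tower_eventually_eq)

/-- **The kernel `stub_dichotomy_dimGETwo` ⟺ all its terminal-dimension slices (`e ≥ 2`).**  Left: the registered
text verbatim.  Right: for every `e ≥ 2`, the same text with `∃ m₀ ≥ m, ∀ n ≥ m₀, ringKrullDim T_n = e` inserted
after the hypothesis «all successors have dimension `≥ 2`».  (⇐) by eventual constancy of the stage dimension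
(`NoZeno.Birth.exists_ringKrullDim_tower_eventually_eq`); (⇒) forgets the slice hypothesis. [cite: Matsumura1987, Thm. 15.5] [folklore] -/
theorem dichotomy_dimGETwo_iff_forall_terminalDim :
    (∀ p : ℕ, p.Prime → ∀ (k K : Type) [Field k] [CharP k p] [Field K] [Algebra k K] (O : ValuationSubring K) (A : Subalgebra k K), (∀ c : k, algebraMap k K c ∈ O) → A.FG → IsFractionRing ↥A K → A.toSubring ≤ O.toSubring → let ca : Subalgebra k K → Set K := fun A => {x : K | ∃ hx : x ∈ A, ∃ n : ℕ, ∀ i : ℕ, n ≤ i → ∀ (M N : ModuleCat.{0} ↥A), Module.Finite ↥A M → Module.Finite ↥A N → ∀ e : CategoryTheory.Abelian.Ext.{0} M N i, (⟨x, hx⟩ : ↥A) • e = 0}; let loc : Subalgebra k K → Subalgebra k K := fun A => Algebra.adjoin k {y : K | ∃ a ∈ A, ∃ s ∈ A, s⁻¹ ∈ O ∧ y = a * s⁻¹}; let chart : Subalgebra k K → Subalgebra k K := fun A => Algebra.adjoin k ((A : Set K) ∪ {y : K | ∃ c ∈ ca A, ∃ x ∈ ca A, x ≠ 0 ∧ (∀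 c' ∈ ca A, c' * x⁻¹ ∈ O) ∧ y = c * x⁻¹}); let nrm : Subalgebra k K → Subalgebra k K := fun B => Algebra.adjoin k {y : K | IsIntegral ↥B y}; let tower : Subalgebra k K → ℕ → Subalgebra k K := fun A m => @Nat.rec (fun _ => Subalgebra k K) (loc A) (fun _ B => loc (nrm (chart B))) m; let Shape : Subalgebra k K → Prop := fun T => (∃ B : Subalgebra k K, B.FG ∧ B ≤ T ∧ loc B = T ∧ ∀ t ∈ T, ∃ b ∈ B, ∃ s ∈ B, s⁻¹ ∈ O ∧ t = b * s⁻¹) ∧ IsNoetherianRing ↥T ∧ T.toSubring ≤ O.toSubring ∧ ∀ s ∈ T, s⁻¹ ∈ O → s⁻¹ ∈ T; (∀ m : ℕ, Shape (tower A m)) → ∀ m : ℕ, (∀ n : ℕ, m ≤ n → ¬ IsRegularLocalRing ↥(tower A n)) → (∀ n : ℕ, m ≤ n → ¬ ringKrullDim ↥(tower A n) ≤ 1) → (∃ m' : ℕ, m < m' ∧ ∃ y ∈ ca (tower A m'), y ≠ 0 ∧ ∀ x ∈ ca (tower A m), x ≠ 0 → y * x⁻¹ ∉ O) ∨ ∃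 n : ℕ, m ≤ n ∧ tower A (n + 1) = tower A n) ↔
    (∀ e : ℕ, 2 ≤ e → ∀ p : ℕ, p.Prime → ∀ (k K : Type) [Field k] [CharP k p] [Field K] [Algebra k K] (O : ValuationSubring K) (A : Subalgebra k K), (∀ c : k, algebraMap k K c ∈ O) → A.FG → IsFractionRing ↥A K → A.toSubring ≤ O.toSubring → let ca : Subalgebra k K → Set K := fun A => {x : K | ∃ hx : x ∈ A, ∃ n : ℕ, ∀ i : ℕ, n ≤ i → ∀ (M N : ModuleCat.{0} ↥A), Module.Finite ↥A M → Module.Finite ↥A N → ∀ e : CategoryTheory.Abelian.Ext.{0} M N i, (⟨x, hx⟩ : ↥A) • e = 0}; let loc : Subalgebra k K → Subalgebra k K := fun A => Algebra.adjoin k {y : K | ∃ a ∈ A, ∃ s ∈ A, s⁻¹ ∈ O ∧ y = a * s⁻¹}; let chart : Subalgebra k K → Subalgebra k K := fun A => Algebra.adjoin k ((A : Set K) ∪ {y : K | ∃ c ∈ ca A, ∃ x ∈ ca A, x ≠ 0 ∧ (∀ c' ∈ ca A, c' * x⁻¹ ∈ O) ∧ y = c * x⁻¹}); let nrm : Subalgebra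 k K → Subalgebra k K := fun B => Algebra.adjoin k {y : K | IsIntegral ↥B y}; let tower : Subalgebra k K → ℕ → Subalgebra k K := fun A m => @Nat.rec (fun _ => Subalgebra k K) (loc A) (fun _ B => loc (nrm (chart B))) m; let Shape : Subalgebra k K → Prop := fun T => (∃ B : Subalgebra k K, B.FG ∧ B ≤ T ∧ loc B = T ∧ ∀ t ∈ T, ∃ b ∈ B, ∃ s ∈ B, s⁻¹ ∈ O ∧ t = b * s⁻¹) ∧ IsNoetherianRing ↥T ∧ T.toSubring ≤ O.toSubring ∧ ∀ s ∈ T, s⁻¹ ∈ O → s⁻¹ ∈ T; (∀ m : ℕ, Shape (tower A m)) → ∀ m : ℕ, (∀ n : ℕ, m ≤ n → ¬ IsRegularLocalRing ↥(tower A n)) → (∀ n : ℕ, m ≤ n → ¬ ringKrullDim ↥(tower A n) ≤ 1) → (∃ m₀ : ℕ, m ≤ m₀ ∧ ∀ n : ℕ, m₀ ≤ n → ringKrullDim ↥(tower A n) = (e : WithBot ℕ∞)) → (∃ m' : ℕ, m < m' ∧ ∃ y ∈ ca (tower A m'), y ≠ 0 ∧ ∀ x ∈ ca (tower A m), x ≠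 0 → y * x⁻¹ ∉ O) ∨ ∃ n : ℕ, m ≤ n ∧ tower A (n + 1) = tower A n) := by
  constructor
  · intro h e _ p hp k K _ _ _ _ O A hk hA hfr hAO ca loc chart nrm tower Shape hShape m hsing hdim _
    exact h p hp k K O A hk hA hfr hAO hShape m hsing hdim
  · intro h p hp k K _ _ _ _ O A hk hA hfr hAO ca loc chart nrm tower Shape hShape m hsing hdim
    -- the stage dimension is eventually constant, `= e` from `m₁` on
    obtain ⟨m₁, e, -, he⟩ :
        ∃ m₁ e : ℕ, (e : ℕ∞) ≤ Cardinal.toNat (Algebra.trdeg k K) ∧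
          ∀ n : ℕ, m₁ ≤ n → ringKrullDim ↥(tower A n) = e :=
      exists_ringKrullDim_tower_eventually_eq O A hA hfr hAO
    -- on the run from `m` all dimensions are `≥ 2`, so `e ≥ 2`
    have he2 : 2 ≤ e := by
      by_contra hlt
      push Not at hlt
      have hle1 : ringKrullDim ↥(tower A (max m m₁)) ≤ 1 := by
        rw [he (max m m₁) (le_max_right m m₁)]
        exact_mod_cast Nat.lt_succ_iff.mp hlt
      exact hdim (max m m₁) (le_max_left m m₁) hle1
    exact h e he2 p hp k K O A hk hA hfr hAO hShape m hsing hdim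
      ⟨max m m₁, le_max_left m m₁, fun n hn => he n ((le_max_right m m₁).trans hn)⟩

end Summit.ResolutionOfSingularities.ResolutionOfSingularities.Theorems.StrictDrop.Birth.TerminalDim

end
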